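import Mathlib.RingTheory.Derivation.Basic
import Mathlib.Algebra.MvPolynomial.Derivation
import Mathlib.RingTheory.MvPolynomial.Homogeneous
import Mathlib.RingTheory.MvPolynomial.Basic
import Mathlib.Algebra.CharP.Lemmas
import Mathlib.Algebra.Polynomial.Roots
import Mathlib.FieldTheory.Finite.Basic
import Mathlib.Data.Nat.Choose.Sum
import Mathlib.Data.Nat.Choose.Dvd
import HarnessLib

/-!
# `p`-th powers of derivations in characteristic `p`, I: Leibniz for iterates, `D^p` is a
# derivation, and the rank-one `p`-curvature formula `(D + m)^p = D^p + m^p + D^{p-1}(m)`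
# (proofs only)

Topic `Literature/RingTheory/FormalGroups` (it serves the `p`-curvature computation for the
invariant derivations of formal groups of elliptic curves in
`Literature/NumberTheory/EllipticCurves`, on Bost's route to the isogeny theorem: J.-B. Bost,
Publ. Math. IHÉS 93 (2001), §2.1.1–2.1.2 and §3.4.2, Prop. 3.9). For a derivation `D` of a
commutative ring `R` of prime characteristic `p` and `m ∈ R`:

* `iterate_map_mul` — Leibniz's formula `Dⁿ(xy) = Σ C(n,k) Dᵏx · Dⁿ⁻ᵏy`, and
  `iterate_prime_map_mul` — **`D^p` is again a derivation** (N. Jacobson, *Lie algebras*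
  (1962), V.7, p. 186: "if `D` is a derivation of an algebra of characteristic `p` then `D^p`
  is a derivation"; N. M. Katz, *Nilpotent connections and the monodromy theorem*, Publ. Math.
  IHÉS 39 (1970), (5.0.5));
* `iterate_add_mul_eq_sum` — `(D + m)ⁿ(r) = Σ C(n,k) W_{n-k} Dᵏ(r)` where `W₀ = 1`,
  `W_{n+1} = D(W_n) + m·W_n` (the `W_n = e^{-f} Dⁿ(e^f)`, `D f = m`, are the complete Bell
  polynomials in `m, Dm, D²m, …`);
* `bell_prime_eq` — **the Bell congruence `W_p = m^p + D^{p-1}(m)` in characteristic `p`**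
  (the universal case `Y_p(x₁, …, x_p) ≡ x₁^p + x_p (mod p)` of the complete Bell polynomials;
  proved here through the universal ring `𝔽_p[x₀, x₁, …]`, the extension by an "exponential"
  `e` with `∂e = x₀ e`, where `∂^p` being a derivation gives `Y_p(a·x) = a·Y_p(x)` for `a ∈ 𝔽_p`,
  and a grading argument);
* `iterate_prime_add_mul` — **the rank-one `p`-curvature formula**
  `(D + m)^p(r) = D^p(r) + (m^p + D^{p-1}(m))·r` (Katz 1970, (5.2)/(7.1.2) for a connection
  `∇ = d + m` on the trivial line bundle: `ψ_p = F^*(…)`, "`(∂ + m)^p = ∂^p + m^p + ∂^{p-1}(m)`";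
  Jacobson, loc. cit., V.7 (63)).

Its sequel `HochschildFormulaProofs.lean` deduces Hochschild's formula
`(gD)^p = g^p D^p + (gD)^{p-1}(g)·D`.

## Sources

* N. Jacobson, *Lie Algebras*, Interscience (1962), Ch. V §7, pp. 186–187 (restricted Lie
  algebra of derivations; Hochschild's formula (63)). [Jacobson1962LieAlgebras]
* N. M. Katz, *Nilpotent connections and the monodromy theorem: applications of a result of
  Turrittin*, Publ. Math. IHÉS 39 (1970), 175–232: (5.0.5), §5.2, (5.3.0) (Hochschild's
  identity), §7.1. [Katz1970Nilpotent]
* G. Hochschild, *Simple algebras with purely inseparable splitting fields of exponent 1*,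
  Trans. AMS 79 (1955), 477–489, Lemma 1. [Hochschild1955]
* J.-B. Bost, Publ. Math. IHÉS 93 (2001), §2.1, §3.4.2. [Bost2001AlgebraicLeaves]

## Design notes

Theorems only (no definitions, no named facts). Derivations are Mathlib `Derivation S R R`
(any commutative ring `R`, any scalars `S`), iterates are `(⇑D)^[n]`; the sequences `W_n` (and the universal `Y_n`)
are quantified over ("any sequence satisfying the recursion") rather than defined.
-/

noncomputable section

open Finset MvPolynomial

namespace Literature.RingTheory.FormalGroups

namespace DerivationPthPower

/-! ### Leibniz for iterates; `D^p` is a derivation -/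

section Leibniz

variable {R : Type*} [CommRing R] {S : Type*} [CommSemiring S] [Algebra S R]
  (D : Derivation S R R)

/-- A derivation commutes with natural-number multiples. [folklore] -/
theorem map_natCast_mul (n : ℕ) (x : R) : D ((n : R) * x) = (n : R) * D x := by
  rw [← nsmul_eq_mul, map_nsmul, nsmul_eq_mul]

/-- **Leibniz's formula for the iterates of a derivation**:
`Dⁿ(xy) = Σ_{k ≤ n} C(n,k) · Dᵏ(x) · Dⁿ⁻ᵏ(y)`. [cite: Jacobson1962LieAlgebras, V.7] -/
theorem iterate_map_mul (x y : R) (n : ℕ) :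
    (⇑D)^[n] (x * y) =
      ∑ k ∈ range (n + 1), (n.choose k : R) * ((⇑D)^[k] x * (⇑D)^[n - k] y) := by
  induction n with
  | zero => simp
  | succ n ih =>
    rw [Function.iterate_succ_apply', ih, map_sum]
    have hterm : ∀ k ∈ range (n + 1), D ((n.choose k : R) * ((⇑D)^[k] x * (⇑D)^[n - k] y)) =
        (n.choose k : R) * ((⇑D)^[k] x * (⇑D)^[n + 1 - k] y) +
          (n.choose k : R) * ((⇑D)^[k + 1] x * (⇑D)^[n - k] y) := by
      intro k hk
      have hk' : k ≤ n := Nat.lt_succ_iff.mp (mem_range.mp hk)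
      have e1 : (⇑D)^[n + 1 - k] y = D ((⇑D)^[n - k] y) := by
        rw [show n + 1 - k = (n - k) + 1 by omega, Function.iterate_succ_apply']
      have e2 : (⇑D)^[k + 1] x = D ((⇑D)^[k] x) := Function.iterate_succ_apply' _ _ _
      rw [map_natCast_mul, Derivation.leibniz, smul_eq_mul, smul_eq_mul, e1, e2]
      ring
    rw [sum_congr rfl hterm, sum_add_distrib,
      sum_choose_succ_mul (fun i j => (⇑D)^[i] x * (⇑D)^[j] y) n]

/-- **In characteristic `p`, `D^p` is a derivation**: `D^p(xy) = D^p(x)·y + x·D^p(y)` (the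
middle binomial coefficients `C(p,k)`, `0 < k < p`, vanish). [cite: Jacobson1962LieAlgebras, V.7, p. 186] -/
theorem iterate_prime_map_mul (p : ℕ) [hp : Fact p.Prime] [CharP R p] (x y : R) :
    (⇑D)^[p] (x * y) = (⇑D)^[p] x * y + x * (⇑D)^[p] y := by
  have hp0 : p ≠ 0 := hp.out.ne_zero
  have hmemp : p ∈ range (p + 1) := mem_range.mpr (Nat.lt_succ_self p)
  have hmem0 : 0 ∈ (range (p + 1)).erase p := by
    rw [mem_erase, mem_range]
    exact ⟨fun h => hp0 h.symm, Nat.succ_pos p⟩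
  rw [iterate_map_mul, ← add_sum_erase _ _ hmemp, ← add_sum_erase _ _ hmem0, Nat.choose_self,
    Nat.choose_zero_right, Nat.cast_one, one_mul, one_mul, Nat.sub_self, Nat.sub_zero,
    Function.iterate_zero_apply, Function.iterate_zero_apply, sum_eq_zero, add_zero]
  intro k hk
  rw [mem_erase, mem_erase, mem_range] at hk
  obtain ⟨hk0, hkp, hklt⟩ := hk
  have hk1 : k < p := lt_of_le_of_ne (Nat.lt_succ_iff.mp hklt) hkp
  have hdvd : p ∣ p.choose k := hp.out.dvd_choose_self hk0 hk1
  rw [(CharP.cast_eq_zero_iff R p _).mpr hdvd, zero_mul]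

/-- `D^p` packaged as a derivation (characteristic `p`). [cite: Jacobson1962LieAlgebras, V.7] -/
theorem exists_derivation_eq_iterate_prime (p : ℕ) [Fact p.Prime] [CharP R p] :
    ∃ Dp : Derivation S R R, ∀ x, Dp x = (⇑D)^[p] x := by
  have hpow : ∀ x, ((D : R →ₗ[S] R) ^ p) x = (⇑D)^[p] x := fun x => by
    rw [Module.End.pow_apply]
    rfl
  refine ⟨Derivation.mk' ((D : R →ₗ[S] R) ^ p) fun a b => ?_, fun x => ?_⟩
  · rw [hpow, hpow, hpow, iterate_prime_map_mul D p, smul_eq_mul, smul_eq_mul]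
    ring
  · rw [Derivation.coe_mk', hpow]

end Leibniz

/-! ### The rank-one expansion `(D + m)ⁿ(r) = Σ C(n,k) W_{n-k} Dᵏ(r)` -/

section RankOne

variable {R : Type*} [CommRing R] {S : Type*} [CommSemiring S] [Algebra S R]
  (D : Derivation S R R) (m : R)
  {W : ℕ → R} (hW0 : W 0 = 1) (hW : ∀ n, W (n + 1) = D (W n) + m * W n)

include hW0 hW in
/-- **`(D + m)ⁿ(r) = Σ_{k ≤ n} C(n,k) · W_{n-k} · Dᵏ(r)`** for the sequence `W₀ = 1`,
`W_{n+1} = D(W_n) + m W_n` (the complete Bell polynomials in `m, Dm, D²m, …`; heuristically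
`W_n = e^{-f} Dⁿ(e^f)` with `Df = m`, and `D + m = e^{-f} ∘ D ∘ e^{f}`). [cite: Katz1970Nilpotent, §5.2] -/
theorem iterate_add_mul_eq_sum (r : R) (n : ℕ) :
    (fun x => D x + m * x)^[n] r =
      ∑ k ∈ range (n + 1), (n.choose k : R) * (W (n - k) * (⇑D)^[k] r) := by
  induction n with
  | zero => simp [hW0]
  | succ n ih =>
    rw [Function.iterate_succ_apply', ih, map_sum, mul_sum, ← sum_add_distrib]
    have hterm : ∀ k ∈ range (n + 1),
        D ((n.choose k : R) * (W (n - k) * (⇑D)^[k] r)) +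
          m * ((n.choose k : R) * (W (n - k) * (⇑D)^[k] r)) =
        (n.choose k : R) * (W (n + 1 - k) * (⇑D)^[k] r) +
          (n.choose k : R) * (W (n - k) * (⇑D)^[k + 1] r) := by
      intro k hk
      have hk' : k ≤ n := Nat.lt_succ_iff.mp (mem_range.mp hk)
      have e1 : W (n + 1 - k) = D (W (n - k)) + m * W (n - k) := by
        rw [show n + 1 - k = (n - k) + 1 by omega, hW]
      have e2 : (⇑D)^[k + 1] r = D ((⇑D)^[k] r) := Function.iterate_succ_apply' _ _ _
      rw [map_natCast_mul, Derivation.leibniz, smul_eq_mul, smul_eq_mul, e1, e2]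
      ring
    rw [sum_congr rfl hterm, sum_add_distrib,
      sum_choose_succ_mul (fun i j => W j * (⇑D)^[i] r) n]

include hW0 hW in
/-- **`(D + m)^p(r) = D^p(r) + W_p · r` in characteristic `p`** (the middle binomial
coefficients vanish). [cite: Katz1970Nilpotent, §5.2] -/
theorem iterate_prime_add_mul_eq (p : ℕ) [hp : Fact p.Prime] [CharP R p] (r : R) :
    (fun x => D x + m * x)^[p] r = (⇑D)^[p] r + W p * r := by
  have hp0 : p ≠ 0 := hp.out.ne_zero
  have hmemp : p ∈ range (p + 1) := mem_range.mpr (Nat.lt_succ_self p)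
  have hmem0 : 0 ∈ (range (p + 1)).erase p := by
    rw [mem_erase, mem_range]
    exact ⟨fun h => hp0 h.symm, Nat.succ_pos p⟩
  rw [iterate_add_mul_eq_sum D m hW0 hW, ← add_sum_erase _ _ hmemp, ← add_sum_erase _ _ hmem0,
    Nat.choose_self, Nat.choose_zero_right, Nat.cast_one, one_mul, one_mul, Nat.sub_self,
    Nat.sub_zero, hW0, one_mul, Function.iterate_zero_apply, sum_eq_zero, add_zero]
  intro k hk
  rw [mem_erase, mem_erase, mem_range] at hk
  obtain ⟨hk0, hkp, hklt⟩ := hk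
  have hk1 : k < p := lt_of_le_of_ne (Nat.lt_succ_iff.mp hklt) hkp
  have hdvd : p ∣ p.choose k := hp.out.dvd_choose_self hk0 hk1
  rw [(CharP.cast_eq_zero_iff R p _).mpr hdvd, zero_mul]

end RankOne

/-! ### The universal Bell congruence `Y_p ≡ x₀^p + x_{p-1} (mod p)` -/

section Universal

variable (p : ℕ) [hp : Fact p.Prime]

/-- The universal derivation `∂ xᵢ = xᵢ₊₁` of `𝔽_q[x₀, x₁, …]` (local notation, `q` the
characteristic). -/
local notation3 "∂[" q "]" => MvPolynomial.mkDerivation (ZMod q)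
  (fun i : ℕ => (X (i + 1) : MvPolynomial ℕ (ZMod q)))

/-- `∂ xᵢ = xᵢ₊₁`. [folklore] -/
theorem univD_X (i : ℕ) : (∂[p]) (X i) = X (i + 1) :=
  mkDerivation_X _ _ _

/-- **`∂` preserves homogeneity**: each monomial `x^s` goes to `Σᵢ sᵢ x^{s - eᵢ + eᵢ₊₁}`.
[folklore] -/
theorem isHomogeneous_univD {F : MvPolynomial ℕ (ZMod p)} {n : ℕ} (hF : F.IsHomogeneous n) :
    ((∂[p]) F).IsHomogeneous n := by
  have hF' : IsWeightedHomogeneous 1 F n := hF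
  clear hF
  induction hF' using IsWeightedHomogeneous.induction_on with
  | zero => rw [map_zero]; exact isHomogeneous_zero _ _ _
  | add f g _ _ hf hg => rw [map_add]; exact hf.add hg
  | monomial d r hr =>
    rw [mkDerivation_monomial, Finsupp.sum, smul_eq_C_mul]
    refine IsHomogeneous.C_mul ?_ r
    refine IsHomogeneous.sum _ _ _ fun i hi => ?_
    rw [smul_eq_mul]
    have hle : Finsupp.single i 1 ≤ d := by
      rw [Finsupp.single_le_iff]
      exact Nat.one_le_iff_ne_zero.mpr (Finsupp.mem_support_iff.mp hi)
    have hdeg : (d - Finsupp.single i 1).degree + 1 = n := by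
      have := congrArg Finsupp.degree (tsub_add_cancel_of_le hle)
      rw [map_add, Finsupp.degree_single] at this
      rw [this, Finsupp.degree_eq_weight_one]
      exact hr
    rw [← hdeg]
    exact (isHomogeneous_monomial _ rfl).mul (isHomogeneous_X _ _)

/-- Homogeneous components commute with `∂`. [folklore] -/
theorem homogeneousComponent_univD (F : MvPolynomial ℕ (ZMod p)) (d : ℕ) :
    homogeneousComponent d ((∂[p]) F) = (∂[p]) (homogeneousComponent d F) := by
  conv_lhs => rw [← sum_homogeneousComponent F]
  rw [map_sum, map_sum]
  have : ∀ i ∈ range (F.totalDegree + 1), homogeneousComponent d ((∂[p]) (homogeneousComponent i F))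
      = if d = i then (∂[p]) (homogeneousComponent i F) else 0 := fun i _ =>
    homogeneousComponent_of_mem ((mem_homogeneousSubmodule _ _).mpr
      (isHomogeneous_univD p (homogeneousComponent_isHomogeneous i F)))
  rw [sum_congr rfl this, sum_ite_eq]
  split_ifs with h
  · rfl
  · rw [homogeneousComponent_eq_zero _ _ (by rw [mem_range] at h; omega), map_zero]

/-- Homogeneous components and multiplication by `x₀`: degree shifts by one. [folklore] -/
theorem homogeneousComponent_succ_X_mul (F : MvPolynomial ℕ (ZMod p)) (d : ℕ) :
    homogeneousComponent (d + 1) (X 0 * F) = X 0 * homogeneousComponent d F := by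
  conv_lhs => rw [← sum_homogeneousComponent F]
  rw [mul_sum, map_sum]
  have : ∀ i ∈ range (F.totalDegree + 1),
      homogeneousComponent (d + 1) (X 0 * homogeneousComponent i F)
      = if d + 1 = i + 1 then X 0 * homogeneousComponent i F else 0 := fun i _ =>
    homogeneousComponent_of_mem ((mem_homogeneousSubmodule _ _).mpr (by
      simpa only [add_comm] using (isHomogeneous_X _ 0).mul (homogeneousComponent_isHomogeneous i F)))
  rw [sum_congr rfl this]
  simp_rw [Nat.succ_inj]
  rw [sum_ite_eq]
  split_ifs with h
  · rfl
  · rw [homogeneousComponent_eq_zero _ _ (by rw [mem_range] at h; omega), mul_zero]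

/-- `x₀ · F` has no constant part. [folklore] -/
theorem homogeneousComponent_zero_X_mul (F : MvPolynomial ℕ (ZMod p)) :
    homogeneousComponent 0 (X 0 * F) = 0 := by
  rw [homogeneousComponent_zero, coeff_X_mul', if_neg (by simp), C_0]

section Bell

variable {p}
variable {Y : ℕ → MvPolynomial ℕ (ZMod p)} (hY0 : Y 0 = 1)
  (hY : ∀ n, Y (n + 1) = (∂[p]) (Y n) + X 0 * Y n)

/-- Homogeneous components of `1`. [folklore] -/
theorem homogeneousComponent_one (d : ℕ) :
    homogeneousComponent d (1 : MvPolynomial ℕ (ZMod p)) = if d = 0 then 1 else 0 :=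
  homogeneousComponent_of_mem ((mem_homogeneousSubmodule _ _).mpr (isHomogeneous_one _ _))

include hY in
/-- The recursion of the Bell sequence on homogeneous components of positive degree.
[folklore] -/
theorem homogeneousComponent_succ_bell (n d : ℕ) :
    homogeneousComponent (d + 1) (Y (n + 1)) =
      (∂[p]) (homogeneousComponent (d + 1) (Y n)) + X 0 * homogeneousComponent d (Y n) := by
  rw [hY, map_add, homogeneousComponent_univD, homogeneousComponent_succ_X_mul]

include hY in
/-- The recursion of the Bell sequence on the constant part. [folklore] -/
theorem homogeneousComponent_zero_bell (n : ℕ) :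
    homogeneousComponent 0 (Y (n + 1)) = (∂[p]) (homogeneousComponent 0 (Y n)) := by
  rw [hY, map_add, homogeneousComponent_univD, homogeneousComponent_zero_X_mul, add_zero]

include hY0 hY in
/-- `Y_n` has no components of degree `> n`. [folklore] -/
theorem homogeneousComponent_bell_eq_zero_of_lt {n d : ℕ} (h : n < d) :
    homogeneousComponent d (Y n) = 0 := by
  induction n generalizing d with
  | zero =>
    rw [hY0, homogeneousComponent_one, if_neg (by omega)]
  | succ n ih =>
    obtain ⟨d, rfl⟩ : ∃ d', d = d' + 1 := ⟨d - 1, by omega⟩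
    rw [homogeneousComponent_succ_bell hY, ih (by omega), ih (by omega), map_zero, mul_zero,
      add_zero]

include hY0 hY in
/-- **The top component of `Y_n` is `x₀ⁿ`.** [folklore] -/
theorem homogeneousComponent_bell_self (n : ℕ) : homogeneousComponent n (Y n) = X 0 ^ n := by
  induction n with
  | zero => rw [hY0, homogeneousComponent_one, if_pos rfl, pow_zero]
  | succ n ih =>
    rw [homogeneousComponent_succ_bell hY, ih,
      homogeneousComponent_bell_eq_zero_of_lt hY0 hY (Nat.lt_succ_self n), map_zero, zero_add,
      pow_succ, mul_comm]

include hY0 hY in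
/-- **`Y_{n+1}` has no constant part.** [folklore] -/
theorem homogeneousComponent_zero_bell_succ (n : ℕ) : homogeneousComponent 0 (Y (n + 1)) = 0 := by
  induction n with
  | zero => rw [homogeneousComponent_zero_bell hY, hY0, homogeneousComponent_one, if_pos rfl,
      Derivation.map_one_eq_zero]
  | succ n ih => rw [homogeneousComponent_zero_bell hY, ih, map_zero]

include hY0 hY in
/-- **The linear part of `Y_{n+1}` is `xₙ`.** [folklore] -/
theorem homogeneousComponent_one_bell_succ (n : ℕ) :
    homogeneousComponent 1 (Y (n + 1)) = X n := by
  induction n with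
  | zero =>
    rw [homogeneousComponent_succ_bell hY, hY0, homogeneousComponent_one, homogeneousComponent_one,
      if_neg (Nat.succ_ne_zero 0), if_pos rfl, map_zero, zero_add, mul_one]
  | succ n ih =>
    rw [homogeneousComponent_succ_bell hY, ih, homogeneousComponent_zero_bell_succ hY0 hY,
      mul_zero, add_zero, univD_X]

include hY0 hY in
/-- `Y_n` is the sum of its components of degrees `≤ n`. [folklore] -/
theorem bell_eq_sum_homogeneousComponent (n : ℕ) :
    Y n = ∑ d ∈ range (n + 1), homogeneousComponent d (Y n) := by
  set M := max n (Y n).totalDegree with hM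
  have h1 : ∑ d ∈ range (n + 1), homogeneousComponent d (Y n) =
      ∑ d ∈ range (M + 1), homogeneousComponent d (Y n) := by
    refine sum_subset (range_subset_range.mpr (by omega)) fun d hd hd' => ?_
    rw [mem_range] at hd hd'
    exact homogeneousComponent_bell_eq_zero_of_lt hY0 hY (by omega)
  have h2 : ∑ d ∈ range ((Y n).totalDegree + 1), homogeneousComponent d (Y n) =
      ∑ d ∈ range (M + 1), homogeneousComponent d (Y n) := by
    refine sum_subset (range_subset_range.mpr (by omega)) fun d hd hd' => ?_
    rw [mem_range] at hd hd'
    exact homogeneousComponent_eq_zero _ _ (by omega)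
  rw [h1, ← h2, sum_homogeneousComponent]

end Bell

section Exponential

/-- The derivation `∂₂` of `𝔽_q[e, x₀, x₁, …]` with `∂₂ e = x₀ e`, `∂₂ xᵢ = xᵢ₊₁` (`e = X none`,
`xᵢ = X (some i)`; local notation). -/
local notation3 "∂₂[" q "]" => MvPolynomial.mkDerivation (ZMod q)
  (fun o : Option ℕ => (Option.elim o (X (some 0) * X none) (fun i => X (some (i + 1))) :
    MvPolynomial (Option ℕ) (ZMod q)))

/-- `∂₂` extends `∂` along `xᵢ ↦ X (some i)`. [folklore] -/
theorem expD_rename (F : MvPolynomial ℕ (ZMod p)) :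
    (∂₂[p]) (rename some F) = rename some ((∂[p]) F) := by
  induction F using MvPolynomial.induction_on with
  | C a => rw [rename_C, derivation_C, derivation_C, map_zero]
  | add f g hf hg => rw [map_add, map_add, hf, hg, map_add, map_add]
  | mul_X f i ih =>
    rw [map_mul, rename_X, Derivation.leibniz, Derivation.leibniz, mkDerivation_X, mkDerivation_X,
      ih, smul_eq_mul, smul_eq_mul, smul_eq_mul, smul_eq_mul, map_add, map_mul, map_mul, rename_X,
      rename_X]
    rfl

/-- `∂₂ e = x₀ e`. [folklore] -/
theorem expD_e : (∂₂[p]) (X none) = X (some 0) * X none := by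
  rw [mkDerivation_X]
  rfl

/-- **`∂₂ⁿ(eᵏ) = R_n · eᵏ`** for the sequence `R₀ = 1`, `R_{n+1} = ∂R_n + k x₀ R_n` (the Bell
sequence with `x` scaled by `k`). [folklore] -/
theorem iterate_expD_e_pow (k : ℕ) {Rk : ℕ → MvPolynomial ℕ (ZMod p)} (hR0 : Rk 0 = 1)
    (hR : ∀ n, Rk (n + 1) = (∂[p]) (Rk n) + (k : MvPolynomial ℕ (ZMod p)) * X 0 * Rk n) (n : ℕ) :
    (⇑(∂₂[p]))^[n] (X none ^ k) = rename some (Rk n) * X none ^ k := by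
  induction n with
  | zero => rw [Function.iterate_zero_apply, hR0, map_one, one_mul]
  | succ n ih =>
    rw [Function.iterate_succ_apply', ih, Derivation.leibniz, Derivation.leibniz_pow, expD_e,
      expD_rename, hR, map_add, map_mul, map_mul, map_natCast, rename_X, smul_eq_mul, smul_eq_mul]
    rcases Nat.eq_zero_or_pos k with rfl | hk
    · simp
    · have hpow : (X none : MvPolynomial (Option ℕ) (ZMod p)) ^ k = X none ^ (k - 1) * X none := by
        rw [← pow_succ, Nat.sub_add_cancel hk]
      rw [nsmul_eq_mul, smul_eq_mul, hpow]
      ring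

/-- **The scaling identity `R^{(k)}_p = k · Y_p`** (`Y = R^{(1)}`): compare `∂₂^p(eᵏ) = R^{(k)}_p eᵏ`
with the Leibniz rule for the DERIVATION `∂₂^p` (characteristic `p`),
`∂₂^p(eᵏ) = k e^{k-1} ∂₂^p(e) = k Y_p eᵏ`, and cancel `eᵏ`. [folklore] -/
theorem bell_scaled_prime_eq (k : ℕ) {Rk Y : ℕ → MvPolynomial ℕ (ZMod p)} (hR0 : Rk 0 = 1)
    (hR : ∀ n, Rk (n + 1) = (∂[p]) (Rk n) + (k : MvPolynomial ℕ (ZMod p)) * X 0 * Rk n)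
    (hY0 : Y 0 = 1) (hY : ∀ n, Y (n + 1) = (∂[p]) (Y n) + X 0 * Y n) :
    Rk p = (k : MvPolynomial ℕ (ZMod p)) * Y p := by
  have hY' : ∀ n, Y (n + 1) = (∂[p]) (Y n) + ((1 : ℕ) : MvPolynomial ℕ (ZMod p)) * X 0 * Y n := by
    intro n; rw [hY, Nat.cast_one, one_mul]
  obtain ⟨Dp, hDp'⟩ := exists_derivation_eq_iterate_prime (∂₂[p]) p
  have h1 : (⇑(∂₂[p]))^[p] (X none ^ k) = rename some (Rk p) * X none ^ k :=
    iterate_expD_e_pow p k hR0 hR p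
  have h2 : (⇑(∂₂[p]))^[p] (X none) = rename some (Y p) * X none := by
    have := iterate_expD_e_pow p 1 hY0 hY' p
    rwa [pow_one] at this
  have h3 : (⇑(∂₂[p]))^[p] (X none ^ k) =
      (k : MvPolynomial (Option ℕ) (ZMod p)) * rename some (Y p) * X none ^ k := by
    rw [← hDp', Dp.leibniz_pow, hDp', h2, nsmul_eq_mul, smul_eq_mul]
    rcases Nat.eq_zero_or_pos k with rfl | hk
    · simp
    · have hpow : (X none : MvPolynomial (Option ℕ) (ZMod p)) ^ k = X none ^ (k - 1) * X none := by
        rw [← pow_succ, Nat.sub_add_cancel hk]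
      rw [hpow]
      ring
  rw [h1] at h3
  have hne : (X none : MvPolynomial (Option ℕ) (ZMod p)) ^ k ≠ 0 := pow_ne_zero _ (X_ne_zero _)
  have h4 : rename some (Rk p) =
      rename some ((k : MvPolynomial ℕ (ZMod p)) * Y p) := by
    rw [map_mul, map_natCast]
    exact mul_right_cancel₀ hne h3
  exact rename_injective _ (Option.some_injective _) h4

end Exponential

section Scaling

/-- The scaling `xᵢ ↦ k xᵢ` commutes with `∂`. [folklore] -/
theorem scale_univD (k : ℕ) (F : MvPolynomial ℕ (ZMod p)) :
    aeval (fun i => (k : MvPolynomial ℕ (ZMod p)) * X i) ((∂[p]) F) =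
      (∂[p]) (aeval (fun i => (k : MvPolynomial ℕ (ZMod p)) * X i) F) := by
  induction F using MvPolynomial.induction_on with
  | C a => rw [derivation_C, map_zero, aeval_C, algebraMap_eq, derivation_C]
  | add f g hf hg => rw [map_add, map_add, hf, hg, map_add, map_add]
  | mul_X f i ih =>
    have hC : (∂[p]) ((k : MvPolynomial ℕ (ZMod p)) * X i) =
        (k : MvPolynomial ℕ (ZMod p)) * X (i + 1) := by
      rw [← map_natCast (C : ZMod p →+* MvPolynomial ℕ (ZMod p)) k, Derivation.leibniz,
        derivation_C, smul_zero, add_zero, mkDerivation_X, smul_eq_mul]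
    rw [Derivation.leibniz, mkDerivation_X, map_add, smul_eq_mul, smul_eq_mul, map_mul, map_mul,
      aeval_X, aeval_X, ih, map_mul, aeval_X, Derivation.leibniz, smul_eq_mul, smul_eq_mul, hC]

/-- The scaling acts on a homogeneous polynomial of degree `d` by `kᵈ`. [folklore] -/
theorem scale_of_isHomogeneous (k : ℕ) {F : MvPolynomial ℕ (ZMod p)} {d : ℕ}
    (hF : F.IsHomogeneous d) :
    aeval (fun i => (k : MvPolynomial ℕ (ZMod p)) * X i) F =
      (k : MvPolynomial ℕ (ZMod p)) ^ d * F := by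
  have hF' : IsWeightedHomogeneous 1 F d := hF
  clear hF
  induction hF' using IsWeightedHomogeneous.induction_on with
  | zero => rw [map_zero, mul_zero]
  | add f g _ _ hf hg => rw [map_add, hf, hg, mul_add]
  | monomial s r hr =>
    rw [aeval_monomial, monomial_eq, Finsupp.prod, Finsupp.prod]
    simp_rw [mul_pow]
    rw [prod_mul_distrib, prod_pow_eq_pow_sum]
    have hdeg : ∑ i ∈ s.support, s i = d := by
      rw [← hr, Finsupp.weight_apply, Finsupp.sum]
      simp
    rw [hdeg, algebraMap_eq]
    ring

end Scaling

/-- **The universal Bell congruence**: for the universal Bell sequence `Y₀ = 1`,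
`Y_{n+1} = ∂Y_n + x₀ Y_n` in `𝔽_p[x₀, x₁, …]` (`∂xᵢ = xᵢ₊₁`), **`Y_p = x₀^p + x_{p-1}`** — i.e. the
complete Bell polynomial `Y_p(x₁, …, x_p) ≡ x₁^p + x_p (mod p)`. Proof: the scalings
`xᵢ ↦ k xᵢ`, `k ∈ 𝔽_p`, satisfy `Y_p(kx) = k Y_p(x)` (`bell_scaled_prime_eq`, via the exponential
`e` and the derivation `∂₂^p`); writing `Y_p = Σ_d H_d` in homogeneous components, the polynomial
`Σ_{d<p} H_d (Aᵈ - A)` of degree `< p` vanishes at the `p` elements of `𝔽_p`, hence is zero, so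
`H_d = 0` for `2 ≤ d < p`; and `H_0 = 0`, `H_1 = x_{p-1}`, `H_p = x₀^p`.
[cite: Jacobson1962LieAlgebras, V.7, pp. 186–187] -/
theorem bell_prime_univ {Y : ℕ → MvPolynomial ℕ (ZMod p)} (hY0 : Y 0 = 1)
    (hY : ∀ n, Y (n + 1) = (∂[p]) (Y n) + X 0 * Y n) :
    Y p = X 0 ^ p + X (p - 1) := by
  have hp1 : 1 ≤ p := hp.out.one_lt.le
  have hp2 : 2 ≤ p := hp.out.two_le
  -- the scaling identities `Y_p(kx) = k Y_p(x)`
  have hscale : ∀ k : ℕ, aeval (fun i => (k : MvPolynomial ℕ (ZMod p)) * X i) (Y p) =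
      (k : MvPolynomial ℕ (ZMod p)) * Y p := by
    intro k
    set Rk : ℕ → MvPolynomial ℕ (ZMod p) :=
      fun n => aeval (fun i => (k : MvPolynomial ℕ (ZMod p)) * X i) (Y n) with hRk
    have hR0 : Rk 0 = 1 := by simp only [hRk, hY0, map_one]
    have hR : ∀ n, Rk (n + 1) = (∂[p]) (Rk n) + (k : MvPolynomial ℕ (ZMod p)) * X 0 * Rk n := by
      intro n
      simp only [hRk]
      rw [hY, map_add, scale_univD, map_mul, aeval_X, mul_assoc]
    exact bell_scaled_prime_eq p k hR0 hR hY0 hY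
  -- homogeneous components
  have hsum : Y p = ∑ d ∈ range (p + 1), homogeneousComponent d (Y p) :=
    bell_eq_sum_homogeneousComponent hY0 hY p
  have hHp : homogeneousComponent p (Y p) = X 0 ^ p := homogeneousComponent_bell_self hY0 hY p
  have hH1 : homogeneousComponent 1 (Y p) = X (p - 1) := by
    have := homogeneousComponent_one_bell_succ hY0 hY (p - 1)
    rwa [Nat.sub_add_cancel hp1] at this
  have hH0 : homogeneousComponent 0 (Y p) = 0 := by
    have := homogeneousComponent_zero_bell_succ hY0 hY (p - 1)
    rwa [Nat.sub_add_cancel hp1] at this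
  -- the scalings act diagonally: `Σ_d kᵈ H_d = k Σ_d H_d`
  have hdiag : ∀ k : ℕ, ∑ d ∈ range (p + 1), (k : MvPolynomial ℕ (ZMod p)) ^ d *
      homogeneousComponent d (Y p) = (k : MvPolynomial ℕ (ZMod p)) * Y p := by
    intro k
    have h := hscale k
    conv_lhs at h => rw [hsum, map_sum]
    rw [sum_congr rfl fun d _ =>
      scale_of_isHomogeneous p k (homogeneousComponent_isHomogeneous d (Y p))] at h
    exact h
  -- the auxiliary one-variable polynomial `Q(A) = Σ_{d<p} H_d (Aᵈ - A)`
  set Q : Polynomial (MvPolynomial ℕ (ZMod p)) := ∑ d ∈ range p,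
    Polynomial.C (homogeneousComponent d (Y p)) * (Polynomial.X ^ d - Polynomial.X) with hQ
  have hQeval : ∀ a : ZMod p, Q.eval (C a) = 0 := by
    intro a
    have hk : ((a.val : ℕ) : MvPolynomial ℕ (ZMod p)) = C a := by
      rw [← map_natCast C a.val, ZMod.natCast_zmod_val]
    have hfrob : (C a : MvPolynomial ℕ (ZMod p)) ^ p = C a := by rw [← map_pow, ZMod.pow_card]
    have key := hdiag a.val
    have hsum' : C a * Y p = ∑ d ∈ range (p + 1), C a * homogeneousComponent d (Y p) := by
      rw [← mul_sum]
      exact congrArg (fun z => C a * z) hsum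
    rw [hk, hsum', sum_range_succ, sum_range_succ, hfrob] at key
    -- `Σ_{d<p} (C a)ᵈ H_d = C a · Σ_{d<p} H_d`
    have key' : ∑ d ∈ range p, (C a) ^ d * homogeneousComponent d (Y p) =
        ∑ d ∈ range p, C a * homogeneousComponent d (Y p) := add_right_cancel key
    rw [hQ, Polynomial.eval_finsetSum]
    simp only [Polynomial.eval_mul, Polynomial.eval_C, Polynomial.eval_sub, Polynomial.eval_pow,
      Polynomial.eval_X, mul_sub]
    rw [sum_sub_distrib, sub_eq_zero]
    refine (sum_congr rfl fun d _ => mul_comm _ _).trans (key'.trans (sum_congr rfl fun d _ => ?_))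
    exact mul_comm _ _
  have hQdeg : Q.natDegree < p := by
    have : Q.natDegree ≤ p - 1 := by
      rw [hQ]
      refine Polynomial.natDegree_sum_le_of_forall_le _ _ fun d hd => ?_
      rw [mem_range] at hd
      refine (Polynomial.natDegree_C_mul_le _ _).trans ((Polynomial.natDegree_sub_le _ _).trans ?_)
      rw [Polynomial.natDegree_X_pow, Polynomial.natDegree_X]
      exact max_le (by omega) (by omega)
    omega
  have hQ0 : Q = 0 :=
    Polynomial.eq_zero_of_natDegree_lt_card_of_eval_eq_zero Q (C_injective ℕ (ZMod p)) hQeval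
      (by rwa [ZMod.card])
  -- hence `H_d = 0` for `2 ≤ d < p`
  have hHmid : ∀ d, 2 ≤ d → d < p → homogeneousComponent d (Y p) = 0 := by
    intro d hd2 hdp
    have hc : Q.coeff d = 0 := by rw [hQ0, Polynomial.coeff_zero]
    rw [hQ, Polynomial.finsetSum_coeff] at hc
    simp only [Polynomial.coeff_C_mul, Polynomial.coeff_sub, Polynomial.coeff_X_pow,
      Polynomial.coeff_X, mul_sub] at hc
    rw [sum_sub_distrib] at hc
    have h1 : ∑ x ∈ range p, homogeneousComponent x (Y p) * (if d = x then 1 else 0) =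
        homogeneousComponent d (Y p) := by
      simp_rw [mul_ite, mul_one, mul_zero]
      rw [sum_ite_eq, if_pos (mem_range.mpr hdp)]
    have h2 : ∑ x ∈ range p, homogeneousComponent x (Y p) * (if 1 = d then 1 else 0) = 0 := by
      refine sum_eq_zero fun x _ => ?_
      rw [if_neg (by omega), mul_zero]
    rw [h1, h2, sub_zero] at hc
    exact hc
  -- assemble
  rw [hsum]
  have hterm : ∀ d ∈ range (p + 1), homogeneousComponent d (Y p) =
      (if d = p then X 0 ^ p else 0) + (if d = 1 then X (p - 1) else 0) := by
    intro d hd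
    rw [mem_range] at hd
    by_cases hdp : d = p
    · subst hdp
      rw [if_pos rfl, if_neg (by omega), add_zero, hHp]
    · rw [if_neg hdp]
      by_cases hd1 : d = 1
      · subst hd1
        rw [if_pos rfl, zero_add, hH1]
      · rw [if_neg hd1, add_zero]
        rcases Nat.lt_or_ge d 2 with h | h
        · obtain rfl : d = 0 := by omega
          exact hH0
        · exact hHmid d h (by omega)
  rw [sum_congr rfl hterm, sum_add_distrib, sum_ite_eq', sum_ite_eq',
    if_pos (mem_range.mpr (Nat.lt_succ_self p)), if_pos (mem_range.mpr (by omega))]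

/-! ### Transfer to an arbitrary ring of characteristic `p` -/

/-- **The Bell congruence in any commutative ring of characteristic `p`**: for a derivation
`D` and `m ∈ R`, the sequence `W₀ = 1`, `W_{n+1} = D(W_n) + m W_n` has
`W_p = m^p + D^{p-1}(m)` (image of the universal `Y_p = x₀^p + x_{p-1}` under
`xᵢ ↦ Dⁱ(m)`). [cite: Jacobson1962LieAlgebras, V.7, pp. 186–187] -/
theorem bell_prime_eq {R : Type*} [CommRing R] [CharP R p] {S : Type*} [CommSemiring S]
    [Algebra S R] (D : Derivation S R R) (m : R)
    {W : ℕ → R} (hW0 : W 0 = 1) (hW : ∀ n, W (n + 1) = D (W n) + m * W n) :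
    W p = m ^ p + (⇑D)^[p - 1] m := by
  let φ : MvPolynomial ℕ (ZMod p) →+* R :=
    eval₂Hom (ZMod.castHom (dvd_refl p) R) (fun i => (⇑D)^[i] m)
  have hφC : ∀ a : ZMod p, D (φ (C a)) = 0 := by
    intro a
    have h1 : φ (C a) = (a.val : R) := by
      simp only [φ, eval₂Hom_C, ZMod.castHom_apply, ZMod.cast_eq_val]
    rw [h1, D.map_natCast]
  have hφD : ∀ F, φ ((∂[p]) F) = D (φ F) := by
    intro F
    induction F using MvPolynomial.induction_on with
    | C a => rw [derivation_C, map_zero, hφC]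
    | add f g hf hg => rw [map_add, map_add, hf, hg, map_add, map_add]
    | mul_X f i ih =>
      rw [Derivation.leibniz, mkDerivation_X, map_add, smul_eq_mul, smul_eq_mul, map_mul, map_mul,
        map_mul, ih, Derivation.leibniz, smul_eq_mul, smul_eq_mul]
      simp only [φ, eval₂Hom_X', Function.iterate_succ_apply']
  let Yu : ℕ → MvPolynomial ℕ (ZMod p) := fun n =>
    Nat.rec (motive := fun _ => MvPolynomial ℕ (ZMod p)) 1 (fun _ y => (∂[p]) y + X 0 * y) n
  have hYu0 : Yu 0 = 1 := rfl
  have hYu : ∀ n, Yu (n + 1) = (∂[p]) (Yu n) + X 0 * Yu n := fun n => rfl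
  have hφY : ∀ n, φ (Yu n) = W n := by
    intro n
    induction n with
    | zero => rw [hYu0, map_one, hW0]
    | succ n ih =>
      rw [hYu, map_add, map_mul, hφD, ih, hW]
      simp only [φ, eval₂Hom_X', Function.iterate_zero_apply]
  rw [← hφY, bell_prime_univ p hYu0 hYu, map_add, map_pow]
  simp only [φ, eval₂Hom_X', Function.iterate_zero_apply]

/-- **The rank-one `p`-curvature formula** (Katz 1970, §5.2 / (7.1.2); Jacobson, *Lie
algebras*, V.7): for a derivation `D` of a commutative ring of characteristic `p` and `m ∈ R`,
`(D + m)^p(r) = D^p(r) + (m^p + D^{p-1}(m)) · r` for all `r`. [cite: Katz1970Nilpotent, §5.2] -/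
theorem iterate_prime_add_mul {R : Type*} [CommRing R] [CharP R p] {S : Type*}
    [CommSemiring S] [Algebra S R] (D : Derivation S R R) (m r : R) :
    (fun x => D x + m * x)^[p] r = (⇑D)^[p] r + (m ^ p + (⇑D)^[p - 1] m) * r := by
  let W : ℕ → R := fun n => Nat.rec (motive := fun _ => R) 1 (fun _ w => D w + m * w) n
  have hW0 : W 0 = 1 := rfl
  have hW : ∀ n, W (n + 1) = D (W n) + m * W n := fun n => rfl
  rw [iterate_prime_add_mul_eq D m hW0 hW p r, bell_prime_eq p D m hW0 hW]

end Universal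

end DerivationPthPower

end Literature.RingTheory.FormalGroups
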